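import Mathlib.RingTheory.PowerSeries.WeierstrassPreparation
import Mathlib.RingTheory.AdicCompletion.Basic
import HarnessLib

/-!
# Power series over an `I`-adically complete ring are `(I, X)`-adically complete; a Weierstrass
# divisor divides no nonzero scalar multiple it does not already divide; swapping the variables of
# an iterated power series ring (proofs only)

Topic `RingTheory/PowerSeries` (theorems only: no definition, no named fact, no instance). Three
pieces of commutative algebra around Mathlib's Weierstrass division at a general ideal
(`PowerSeries.IsWeierstrassDivisorAt g J`, `….mod'`, which require `[IsAdicComplete J A]`):

* **`isAdicComplete_powerSeries_map_C_sup_span_X`** — if `R` is `I`-adically complete then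
  `R⟦X⟧` is `J`-adically complete for `J = I·R⟦X⟧ + (X)`; with the membership description of the
  powers `Jᵏ` (`coeff_mem_pow_of_mem_map_C_sup_span_X_pow`: `f ∈ Jᵏ ⇒ [Xⁱ]f ∈ I^(k−i)`, and the
  converse `mem_map_C_sup_span_X_pow_of_coeff_mem_pow`). The tree's
  `Literature.NumberTheory.GaloisRepresentations.powerSeries_isAdicComplete_maximalIdeal` is the
  case `I = 𝔪` of a local ring; the general ideal is what a NON-noetherian coefficient ring such as
  `𝒪_{ℂ_p}` (complete for `(ϖ)`, not for its maximal ideal) needs.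
* **`dvd_of_isWeierstrassDivisorAt_of_dvd_C_mul`** — over a domain `A` complete for `J`, a
  Weierstrass divisor `g ∈ A⟦X⟧` at `J` (some coefficient a unit, all lower ones in `J`;
  `isWeierstrassDivisorAt_of_coeff_mem_of_isUnit`) satisfies `g ∣ C a · f ⇒ g ∣ f` for every
  scalar `a ≠ 0`: the quotient `A⟦X⟧/(g)` embeds `A`-linearly into `A[X]` (Mathlib's `mod'`), so it
  is torsion-free.
* **`exists_ringEquiv_powerSeries_swap`** — the ring automorphism of `R⟦X⟧⟦Y⟧` exchanging the two
  variables, stated as an existence theorem with its coefficient formula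
  (`[Yᵃ][Xᵇ](σ G) = [Yᵇ][Xᵃ] G`), so that Weierstrass division "in the inner variable" is available.

Used by `Literature/NumberTheory/EllipticCurves/YanZhu2026/GreenbergDivisibilityProofs.lean` (the
second step of the proof of [Yan–Zhu 2026, Thm. 4.2 (2)] over `𝒪_{ℂ_p}⟦T₁⟧⟦T₂⟧`).

## References (locators checked on the held texts)
* [Bourbaki1989CommAlg] N. Bourbaki, *Commutative Algebra*, Ch. III §2 no. 6, Prop. 6 and the remark
  after it: for ANY ideal `𝔪` of `A` with the `𝔪`-adic filtration, the `𝔫`-adic filtration of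
  `A' = A[[X₁,…,X_s]]` (`𝔫 = (𝔪, X₁, …, X_s)`) is `𝔞′ₖ = {P : α_{e,P} ∈ 𝔪^{k−|e|}}`, `𝔫ᵏ = 𝔞′ₖ`, and
  `A'` is separated / complete when `A` is `[corpus: book:bourbaki2006-algebre-commutative p0184
  (Prop. 6), p0185 L7 (𝔫ᵏ = 𝔞′ₖ, Corollaire)]`.
* [BourbakiAC5to7] N. Bourbaki, *Algèbre commutative*, Ch. VII §3 no. 8, Prop. 5: `B = A[[X]]`,
  `f` of reduced order `s` ⇒ `B = M ⊕ fB` with `M` the free `A`-module on `1, …, X^{s−1}`, and `f` is a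
  non-zero-divisor `[corpus: book:bourbakind-elements-de-mathematique-algebre-commutative p0224 L21
  (setting), p0225 (Prop. 5 and proof)]`.
* [BourbakiAlgebraI1989] N. Bourbaki, *Algebra I*, Ch. III §2 no. 11: the algebra isomorphism of
  `A[[Xᵢ]]` induced by a bijection of the indeterminates, and `A[[Xᵢ]]_{i∈I} = (A[[Xⱼ]]_{j∈J})[[Xₖ]]_{k∈K}`
  `[corpus: book:bourbakind-algebra p0557 L3–L5]`.
-/

noncomputable section

open scoped Classical

namespace Literature.RingTheory.PowerSeries

open _root_.PowerSeries

/-! ## §A. `R⟦X⟧` is `(I·R⟦X⟧ + (X))`-adically complete when `R` is `I`-adically complete -/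

section Adic

variable {R : Type*} [CommRing R] (I : Ideal R)

/-- The coefficients of an element of the extended ideal `I·R⟦X⟧` lie in `I` (the case `k = 1`,
constant term, of the description of `𝔫ᵏ`). [cite: Bourbaki1989CommAlg, Ch. III §2 no. 6, Prop. 6 and the remark following it (𝔫-adic filtration of A[[X]], 𝔫ᵏ = 𝔞′ₖ)] -/
theorem coeff_mem_of_mem_map_C {f : PowerSeries R} (hf : f ∈ I.map (C (R := R))) (i : ℕ) :
    coeff i f ∈ I := by
  induction hf using Submodule.span_induction generalizing i with
  | mem x hx =>
    obtain ⟨r, hr, rfl⟩ := hx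
    rw [coeff_C]
    split_ifs
    · exact hr
    · exact I.zero_mem
  | zero => simp
  | add x y _ _ hx hy => simpa only [map_add] using I.add_mem (hx i) (hy i)
  | smul a x _ hx =>
    rw [smul_eq_mul]
    exact coeff_mul_mem_ideal_of_coeff_right_mem_ideal' hx i

/-- **Coefficients of `Jᵏ`, `J = I·R⟦X⟧ + (X)`**: if `f ∈ Jᵏ` then `[Xⁱ] f ∈ I^(k−i)` (truncated
subtraction: no condition for `i ≥ k`) — Bourbaki's `𝔫ᵏ ⊂ 𝔞′ₖ` for one indeterminate.
[cite: Bourbaki1989CommAlg, Ch. III §2 no. 6, Prop. 6 and the remark following it (𝔫-adic filtration of A[[X]], 𝔫ᵏ = 𝔞′ₖ)] -/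
theorem coeff_mem_pow_of_mem_map_C_sup_span_X_pow {k : ℕ} {f : PowerSeries R}
    (hf : f ∈ (I.map (C (R := R)) ⊔ Ideal.span {(X : PowerSeries R)}) ^ k) (i : ℕ) :
    coeff i f ∈ I ^ (k - i) := by
  induction k generalizing f i with
  | zero => simp
  | succ k ih =>
    rw [pow_succ] at hf
    refine Submodule.mul_induction_on hf (fun m hm n hn ↦ ?_) (fun x y hx hy ↦ ?_)
    · obtain ⟨y, hy, z, hz, rfl⟩ := Submodule.mem_sup.mp hn
      rw [mul_add, map_add]
      refine Ideal.add_mem _ ?_ ?_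
      · rw [coeff_mul]
        refine Ideal.sum_mem _ fun ab hab ↦ ?_
        have ha : ab.1 ≤ i := by have := Finset.mem_antidiagonal.mp hab; omega
        have h3 : I ^ (k - ab.1) * I ≤ I ^ (k + 1 - i) := by
          rw [← pow_succ]
          exact Ideal.pow_le_pow_right (by omega)
        exact h3 (Ideal.mul_mem_mul (ih hm ab.1) (coeff_mem_of_mem_map_C I hy ab.2))
      · obtain ⟨w, rfl⟩ := Ideal.mem_span_singleton'.mp hz
        rw [← mul_assoc, mul_comm _ (X : PowerSeries R)]
        cases i with
        | zero => simp
        | succ j =>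
          rw [coeff_succ_X_mul, coeff_mul]
          refine Ideal.sum_mem _ fun ab hab ↦ ?_
          have ha : ab.1 ≤ j := by have := Finset.mem_antidiagonal.mp hab; omega
          exact Ideal.pow_le_pow_right (by omega) (Ideal.mul_mem_right _ _ (ih hm ab.1))
    · simpa only [map_add] using Ideal.add_mem _ hx hy

/-- **Conversely**, if `[Xⁱ] f ∈ I^(k−i)` for every `i` then `f ∈ Jᵏ`, `J = I·R⟦X⟧ + (X)` —
Bourbaki's `𝔞′ₖ ⊂ 𝔫ᵏ`. [cite: Bourbaki1989CommAlg, Ch. III §2 no. 6, Prop. 6 and the remark following it (𝔫-adic filtration of A[[X]], 𝔫ᵏ = 𝔞′ₖ)] -/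
theorem mem_map_C_sup_span_X_pow_of_coeff_mem_pow {k : ℕ} {f : PowerSeries R}
    (hf : ∀ i, coeff i f ∈ I ^ (k - i)) :
    f ∈ (I.map (C (R := R)) ⊔ Ideal.span {(X : PowerSeries R)}) ^ k := by
  induction k generalizing f with
  | zero => simp
  | succ k ih =>
    rw [eq_X_mul_shift_add_const f, pow_succ']
    refine Ideal.add_mem _ ?_ ?_
    · refine Ideal.mul_mem_mul (Ideal.mem_sup_right (Ideal.mem_span_singleton_self _))
        (ih fun i ↦ ?_)
      simpa using hf (i + 1)
    · have h0 : constantCoeff f ∈ I ^ (k + 1) := by simpa using hf 0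
      have h1 : C (constantCoeff f) ∈ (I.map (C (R := R))) ^ (k + 1) := by
        rw [← Ideal.map_pow]
        exact Ideal.mem_map_of_mem _ h0
      rw [← pow_succ']
      exact Ideal.pow_right_mono le_sup_left _ h1

/-- `R⟦X⟧` is `J`-adically separated, `J = I·R⟦X⟧ + (X)`, when `R` is `I`-adically separated
("si A est séparé, il en est de même de A′"). [cite: Bourbaki1989CommAlg, Ch. III §2 no. 6, Prop. 6 and the remark following it (𝔫-adic filtration of A[[X]], 𝔫ᵏ = 𝔞′ₖ)] -/
theorem isHausdorff_powerSeries_map_C_sup_span_X [IsHausdorff I R] :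
    IsHausdorff (I.map (C (R := R)) ⊔ Ideal.span {(X : PowerSeries R)}) (PowerSeries R) := by
  refine ⟨fun f hf ↦ ?_⟩
  ext i
  rw [map_zero]
  refine IsHausdorff.haus ‹IsHausdorff I R› _ fun m ↦ ?_
  have h := hf (m + i)
  rw [SModEq.zero, smul_eq_mul, Ideal.mul_top] at h ⊢
  simpa using coeff_mem_pow_of_mem_map_C_sup_span_X_pow I h i

/-- `R⟦X⟧` is `J`-adically precomplete, `J = I·R⟦X⟧ + (X)`, when `R` is `I`-adically precomplete
(coefficientwise limits; "si A est complet, il en est de même de A′"). [cite: Bourbaki1989CommAlg, Ch. III §2 no. 6, Prop. 6 and the remark following it (𝔫-adic filtration of A[[X]], 𝔫ᵏ = 𝔞′ₖ)] -/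
theorem isPrecomplete_powerSeries_map_C_sup_span_X [IsPrecomplete I R] :
    IsPrecomplete (I.map (C (R := R)) ⊔ Ideal.span {(X : PowerSeries R)}) (PowerSeries R) := by
  refine ⟨fun f hf ↦ ?_⟩
  have hlim : ∀ i, ∃ L : R, ∀ m, coeff i (f (m + i)) ≡ L [SMOD (I ^ m • ⊤ : Submodule R R)] := by
    intro i
    refine IsPrecomplete.prec ‹IsPrecomplete I R› fun {m n} hmn ↦ ?_
    have h := hf (Nat.add_le_add_right hmn i)
    rw [SModEq.sub_mem, smul_eq_mul, Ideal.mul_top] at h ⊢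
    simpa using coeff_mem_pow_of_mem_map_C_sup_span_X_pow I h i
  choose L hL using hlim
  refine ⟨PowerSeries.mk L, fun n ↦ ?_⟩
  rw [SModEq.sub_mem, smul_eq_mul, Ideal.mul_top]
  refine mem_map_C_sup_span_X_pow_of_coeff_mem_pow I fun i ↦ ?_
  rcases le_or_gt i n with hin | hin
  · have h := hL i (n - i)
    rw [SModEq.sub_mem, smul_eq_mul, Ideal.mul_top, Nat.sub_add_cancel hin] at h
    simpa using h
  · simp [Nat.sub_eq_zero_of_le hin.le]

/-- **Power series over an `I`-adically complete ring are `(I·R⟦X⟧ + (X))`-adically complete.**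
For `I = 𝔪` of a complete local ring this is the completeness of the local ring `R⟦X⟧`; for
`R = 𝒪_{ℂ_p}` and `I = (ϖ)` it is what Weierstrass division in `𝒪_{ℂ_p}⟦T₁⟧⟦T₂⟧` needs.
Bourbaki states it for any ideal `𝔪` of `A` with the `𝔪`-adic filtration (`s` indeterminates; here
`s = 1`). [cite: Bourbaki1989CommAlg, Ch. III §2 no. 6, Prop. 6 and the remark following it (𝔫-adic filtration of A[[X]], 𝔫ᵏ = 𝔞′ₖ)] -/
theorem isAdicComplete_powerSeries_map_C_sup_span_X [IsAdicComplete I R] :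
    IsAdicComplete (I.map (C (R := R)) ⊔ Ideal.span {(X : PowerSeries R)}) (PowerSeries R) :=
  { isHausdorff_powerSeries_map_C_sup_span_X I, isPrecomplete_powerSeries_map_C_sup_span_X I with }

/-- `J = I·R⟦X⟧ + (X)` is a proper ideal when `I` is (constant terms of `J` lie in `I`).
[cite: Bourbaki1989CommAlg, Ch. III §2 no. 6, Prop. 6 and the remark following it (𝔫-adic filtration of A[[X]], 𝔫ᵏ = 𝔞′ₖ)] -/
theorem map_C_sup_span_X_ne_top (hI : I ≠ ⊤) :
    I.map (C (R := R)) ⊔ Ideal.span {(X : PowerSeries R)} ≠ ⊤ := by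
  intro h
  apply hI
  rw [Ideal.eq_top_iff_one] at h ⊢
  have h1 := coeff_mem_pow_of_mem_map_C_sup_span_X_pow I (k := 1) (by simpa using h) 0
  simpa using h1

end Adic

/-! ## §B. A Weierstrass divisor divides `C a · f` only if it divides `f` (`a ≠ 0` a scalar) -/

section Weierstrass

variable {A : Type*} [CommRing A] {J : Ideal A}

/-- If the coefficients of `g` below index `n` lie in the proper ideal `J` and `[Xⁿ] g ∉ J`, then the
reduction of `g` modulo `J` has order `n` (Bourbaki's "ordre réduit"). [cite: BourbakiAC5to7, Ch. VII §3 no. 8, Prop. 5 (B = M ⊕ fB, f of reduced order s, M free on 1, X, …, X^{s−1})] -/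
theorem order_map_mk_eq_of_coeff_mem {g : PowerSeries A} {n : ℕ} (hlt : ∀ j < n, coeff j g ∈ J)
    (hn : coeff n g ∉ J) : (g.map (Ideal.Quotient.mk J)).order = n := by
  rw [order_eq_nat]
  refine ⟨?_, fun j hj ↦ ?_⟩
  · rwa [coeff_map, Ne, Ideal.Quotient.eq_zero_iff_mem]
  · rw [coeff_map, Ideal.Quotient.eq_zero_iff_mem]
    exact hlt j hj

/-- **A power series with a unit coefficient at index `n` and all lower coefficients in a proper
ideal `J` is a Weierstrass divisor at `J`** (Mathlib's `PowerSeries.IsWeierstrassDivisorAt`; Bourbaki's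
hypothesis "série réduite non nulle, d'ordre réduit `n`"). [cite: BourbakiAC5to7, Ch. VII §3 no. 8, Prop. 5 (B = M ⊕ fB, f of reduced order s, M free on 1, X, …, X^{s−1})] -/
theorem isWeierstrassDivisorAt_of_coeff_mem_of_isUnit (hJ : J ≠ ⊤) {g : PowerSeries A} {n : ℕ}
    (hlt : ∀ j < n, coeff j g ∈ J) (hn : IsUnit (coeff n g)) : g.IsWeierstrassDivisorAt J := by
  have hn' : coeff n g ∉ J := fun h ↦ hJ (Ideal.eq_top_of_isUnit_mem J h hn)
  rw [IsWeierstrassDivisorAt, order_map_mk_eq_of_coeff_mem hlt hn', ENat.toNat_coe]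
  exact hn

/-- **Torsion-freeness of `A⟦X⟧/(g)` for a Weierstrass divisor `g`** (over a domain `A` complete
for `J`): if `g ∣ C a · f` with `a ≠ 0` then `g ∣ f`. Proof: Mathlib's remainder map
`mod' : A⟦X⟧/(g) →ₗ[A] A[X]` is a left inverse of the projection, and `A[X]` has no `A`-torsion —
Bourbaki's `B = M ⊕ fB` with `M` free over `A`. Bourbaki prints it for `A` local and `J = 𝔪`; the proof
(and Mathlib's `IsWeierstrassDivisorAt`) uses only `aᵢ ∈ J` (`i < s`), `a_s` invertible, `A` separated
and complete for `J`, which is the form stated here. [cite: BourbakiAC5to7, Ch. VII §3 no. 8, Prop. 5 (B = M ⊕ fB, f of reduced order s, M free on 1, X, …, X^{s−1})] -/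
theorem dvd_of_isWeierstrassDivisorAt_of_dvd_C_mul [IsDomain A] [IsAdicComplete J A]
    {g : PowerSeries A} (H : g.IsWeierstrassDivisorAt J) {a : A} (ha : a ≠ 0) {f : PowerSeries A}
    (h : g ∣ C a * f) : g ∣ f := by
  set x : PowerSeries A ⧸ Ideal.span {g} := Ideal.Quotient.mk (Ideal.span {g}) f with hx
  have hax : a • x = 0 := by
    have h1 : Ideal.Quotient.mk (Ideal.span {g}) (a • f) = a • x := by
      rw [hx, ← Ideal.Quotient.mkₐ_eq_mk A, map_smul]
    rw [← h1, Ideal.Quotient.eq_zero_iff_mem, Ideal.mem_span_singleton, smul_eq_C_mul]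
    exact h
  have hmod : a • H.mod' x = 0 := by rw [← LinearMap.map_smul, hax, map_zero]
  have hmod' : H.mod' x = 0 := (smul_eq_zero.mp hmod).resolve_left ha
  have hx0 : x = 0 := by
    rw [← H.mk_mod'_eq_self (f := x), hmod', Polynomial.coe_zero, map_zero]
  rwa [hx, Ideal.Quotient.eq_zero_iff_mem, Ideal.mem_span_singleton] at hx0

end Weierstrass

/-! ## §C. Swapping the two variables of `R⟦X⟧⟦Y⟧` -/

section Swap

variable {R : Type*} [CommRing R]

/-- Double coefficients of a product in `R⟦X⟧⟦Y⟧` (the product formula of `A[[X, Y]]` read through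
`A[[X]][[Y]] = A[[X, Y]]`). [cite: BourbakiAlgebraI1989, Ch. III §2 no. 11 (algebra isomorphism of A[[Xᵢ]] from a bijection of the indeterminates; A[[Xᵢ]]_{i∈I} = (A[[Xⱼ]]_{j∈J})[[Xₖ]]_{k∈K})] -/
theorem coeff_coeff_mul (G H : PowerSeries (PowerSeries R)) (a b : ℕ) :
    coeff b (coeff a (G * H)) =
      ∑ ij ∈ Finset.antidiagonal a, ∑ kl ∈ Finset.antidiagonal b,
        coeff kl.1 (coeff ij.1 G) * coeff kl.2 (coeff ij.2 H) := by
  rw [coeff_mul, map_sum]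
  refine Finset.sum_congr rfl fun ij _ ↦ ?_
  rw [coeff_mul]

/-- **The swap automorphism of `R⟦X⟧⟦Y⟧`**: there is a ring automorphism `σ` with
`[Yᵃ][Xᵇ](σ G) = [Yᵇ][Xᵃ] G` for all `G, a, b` (so `σ` exchanges the inner and the outer variable,
`σ (C t) = map C t`, `σ (map C t) = C t`, and `σ ∘ σ = id`). Stated as an existence theorem; the
witness is `G ↦ mk (fun a ↦ mk (fun b ↦ [Yᵇ][Xᵃ] G))` — the composite
`A[[X]][[Y]] = A[[X, Y]] ≅ A[[Y, X]] = A[[Y]][[X]]` of Bourbaki's identifications. [cite: BourbakiAlgebraI1989, Ch. III §2 no. 11 (algebra isomorphism of A[[Xᵢ]] from a bijection of the indeterminates; A[[Xᵢ]]_{i∈I} = (A[[Xⱼ]]_{j∈J})[[Xₖ]]_{k∈K})] -/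
theorem exists_ringEquiv_powerSeries_swap :
    ∃ σ : PowerSeries (PowerSeries R) ≃+* PowerSeries (PowerSeries R),
      ∀ (G : PowerSeries (PowerSeries R)) (a b : ℕ), coeff b (coeff a (σ G)) = coeff a (coeff b G) := by
  let s : PowerSeries (PowerSeries R) → PowerSeries (PowerSeries R) :=
    fun G ↦ PowerSeries.mk fun a ↦ PowerSeries.mk fun b ↦ coeff a (coeff b G)
  have hs : ∀ G a b, coeff b (coeff a (s G)) = coeff a (coeff b G) := fun G a b ↦ by
    simp [s]
  have hss : ∀ G, s (s G) = G := fun G ↦ by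
    ext a b
    rw [hs, hs]
  have hmul : ∀ G H, s (G * H) = s G * s H := fun G H ↦ by
    ext a b
    rw [hs, coeff_coeff_mul, coeff_coeff_mul, Finset.sum_comm]
    refine Finset.sum_congr rfl fun ij _ ↦ Finset.sum_congr rfl fun kl _ ↦ ?_
    rw [hs, hs]
  have hadd : ∀ G H, s (G + H) = s G + s H := fun G H ↦ by
    ext a b
    simp only [hs, map_add]
  let σ : PowerSeries (PowerSeries R) ≃+* PowerSeries (PowerSeries R) :=
    { toFun := s, invFun := s, left_inv := hss, right_inv := hss, map_mul' := hmul, map_add' := hadd }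
  exact ⟨σ, hs⟩

/-- Under a swap `σ` (any map with the coefficient formula), the outer-constant series `C t`
becomes the inner-constant series `map C t`, and conversely. [cite: BourbakiAlgebraI1989, Ch. III §2 no. 11 (algebra isomorphism of A[[Xᵢ]] from a bijection of the indeterminates; A[[Xᵢ]]_{i∈I} = (A[[Xⱼ]]_{j∈J})[[Xₖ]]_{k∈K})] -/
theorem swap_C_eq_map_C {σ : PowerSeries (PowerSeries R) ≃+* PowerSeries (PowerSeries R)}
    (hσ : ∀ (G : PowerSeries (PowerSeries R)) (a b : ℕ), coeff b (coeff a (σ G)) = coeff a (coeff b G))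
    (t : PowerSeries R) :
    σ (C t) = PowerSeries.map (C (R := R)) t ∧ σ (PowerSeries.map (C (R := R)) t) = C t := by
  constructor
  · ext a b
    rw [hσ, coeff_map, coeff_C, coeff_C]
    split_ifs <;> simp
  · ext a b
    rw [hσ, coeff_map, coeff_C, coeff_C]
    split_ifs <;> simp

/-- Under a swap `σ`, the constant coefficient of the `a`-th outer coefficient of `σ G` is the `a`-th
coefficient of the constant (outer) coefficient of `G`: `[X⁰]([Yᵃ] σG) = [Xᵃ]([Y⁰] G)`. [cite: BourbakiAlgebraI1989, Ch. III §2 no. 11 (algebra isomorphism of A[[Xᵢ]] from a bijection of the indeterminates; A[[Xᵢ]]_{i∈I} = (A[[Xⱼ]]_{j∈J})[[Xₖ]]_{k∈K})] -/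
theorem constantCoeff_coeff_swap {σ : PowerSeries (PowerSeries R) ≃+* PowerSeries (PowerSeries R)}
    (hσ : ∀ (G : PowerSeries (PowerSeries R)) (a b : ℕ), coeff b (coeff a (σ G)) = coeff a (coeff b G))
    (G : PowerSeries (PowerSeries R)) (a : ℕ) :
    constantCoeff (coeff a (σ G)) = coeff a (constantCoeff G) := by
  rw [← coeff_zero_eq_constantCoeff_apply, hσ, coeff_zero_eq_constantCoeff_apply]

end Swap

end Literature.RingTheory.PowerSeries

end
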